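import Literature.Geometry.Lorentzian.CoordTensorCalculus
import HarnessLib

/-!
# The Ricci identity for covariant tensor fields of any rank, in coordinates

Second layer of the rank-generic coordinate tensor calculus (`CoordTensorCalculus.lean`), towards
Shi's global derivative estimates for all orders (Topping 2006, Thm. 3.3.1) and the curvature
blow-up theorem (Topping 2006, Thm. 5.3.1). For metric components `G` (`IsMetricOn G V`) and a
basis `b`:

* `riemCoef G b x j k i m = R^m_{jki} = bᵐ(R(b_j,b_k) b_i)` and the lowered curvature tensor as a
  component field of rank four, `rm4 G b x J = G(R(b_{J0}, b_{J1}) b_{J2}, b_{J3}) = R_{J0 J1 J2 J3}`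
  (conventions of `CoordCurvature.lean`: `R(X,Y) = [∇_X, ∇_Y] − ∇_{[X,Y]}`);
* `riemCoef_eq_chrCoef` — `R^m_{jki} = ∂_jΓ^m_{ki} − ∂_kΓ^m_{ji} + Γ^p_{ki}Γ^m_{jp} − Γ^p_{ji}Γ^m_{kp}`;
* **`IsMetricOn.tcov_tcov_antisymm` — the Ricci identity** for a smooth covariant tensor field
  `T` of arbitrary index type `α`:
  `(∇∇T)_{jkI} − (∇∇T)_{kjI} = −Σ_a Σ_m R^m_{jk I_a} T_{I[a ↦ m]}`
  (O'Neill 1983, Ch. 3, Prop. 3.36 ff. / Topping 2006, (2.1.5)–(2.1.6): `R(X,Y)` acts as a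
  derivation on tensors, `∇²_{X,Y} − ∇²_{Y,X} = R(X,Y)`).

Everything is proved; no definition of `Prop` type.

## References

* B. O'Neill, *Semi-Riemannian geometry with applications to relativity*, Academic Press 1983,
  Ch. 2, Prop. 2.13; Ch. 3, Lemma 3.38, Prop. 3.36. [ONeill1983]
* P. Topping, *Lectures on the Ricci flow*, LMS Lecture Note Series 325, CUP 2006, §2.1
  (formulae for commuting covariant derivatives, (2.1.5)–(2.1.6)). [Topping2006]
-/

noncomputable section

set_option maxSynthPendingDepth 3

open Set Filter ContinuousLinearMap Module Function
open scoped Topology ContDiff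

namespace Literature.Geometry.Lorentzian

namespace MetricCoord

variable {E : Type*} [NormedAddCommGroup E] [NormedSpace ℝ E] {ι : Type*}

/-! ### The curvature components -/

section Riem

variable (G : E → E →L[ℝ] E →L[ℝ] ℝ) (b : Basis ι ℝ E)

/-- **Curvature components** `R^m_{jki} = bᵐ(R_x(b_j, b_k) b_i)` (so that
`R(b_j,b_k) b_i = Σ_m R^m_{jki} b_m`). [cite: ONeill1983, Ch. 3, Lemma 3.38] -/
def riemCoef (x : E) (j k i m : ι) : ℝ :=
  b.coord m (riemAt G x (b j) (b k) (b i))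

/-- **The lowered curvature tensor as a rank-four component field**:
`rm4 G b x J = R_{J₀J₁J₂J₃} = G_x(R(b_{J₀}, b_{J₁}) b_{J₂}, b_{J₃})`. [cite: ONeill1983, Ch. 3, Lemma 3.35] -/
def rm4 (x : E) (J : Fin 4 → ι) : ℝ :=
  G x (riemAt G x (b (J 0)) (b (J 1)) (b (J 2))) (b (J 3))

variable {G} {V : Set E} {x : E}

/-- `R(b_j,b_k)b_i = Σ_m R^m_{jki} b_m`. [cite: ONeill1983, Ch. 3, Lemma 3.38] -/
theorem riemAt_basis_eq_sum [Fintype ι] (x : E) (j k i : ι) :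
    riemAt G x (b j) (b k) (b i) = ∑ m, riemCoef G b x j k i m • b m := by
  conv_lhs => rw [← b.sum_repr (riemAt G x (b j) (b k) (b i))]
  rfl

/-- Unfolding lemma for `rm4` on an explicit index vector. [cite: ONeill1983, Ch. 3, Lemma 3.35] -/
@[simp] theorem rm4_vec (x : E) (j k i m : ι) :
    rm4 G b x ![j, k, i, m] = G x (riemAt G x (b j) (b k) (b i)) (b m) := rfl

/-- **Index raising**: `R^m_{jki} = Σ_{m'} g^{mm'} R_{jkim'}`. [cite: ONeill1983, Ch. 3, p. 60] -/
theorem riemCoef_eq_sum_ginv [Fintype ι] [FiniteDimensional ℝ E] (hx : (G x).IsInvertible)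
    (j k i m : ι) : riemCoef G b x j k i m = ∑ m', ginv G b x m m' * rm4 G b x ![j, k, i, m'] := by
  unfold riemCoef
  rw [coord_eq_sum_ginv b hx]
  rfl

/-- The components `rm4` are `C^∞` on `V`. [folklore] -/
theorem IsMetricOn.tsmoothOn_rm4 [CompleteSpace E] (hG : IsMetricOn G V) : TSmoothOn (rm4 G b) V :=
  fun _ ↦ (hG.contDiffOn.clm_apply (hG.contDiffOn_riemAt_apply _ _ _)).clm_apply contDiffOn_const

/-- `∂_v Γ^m_{ki} = bᵐ(DΓ(x)(v)(b_k)(b_i))`. [folklore] -/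
theorem IsMetricOn.fderiv_chrCoef [CompleteSpace E] [FiniteDimensional ℝ E] (hG : IsMetricOn G V)
    (hx : x ∈ V) (k i m : ι) (v : E) :
    fderiv ℝ (fun y ↦ chrCoef G b y k i m) x v = b.coord m (fderiv ℝ (chrAt G) x v (b k) (b i)) := by
  have hD := (hG.differentiableAt_chrAt hx).hasFDerivAt
  have h1 := hasFDerivAt_clm_apply_const hD (b k)
  have h2 := hasFDerivAt_clm_apply_const h1 (b i)
  have h3 := (coordCLM b m).hasFDerivAt.comp x h2
  have hfun : (fun y ↦ chrCoef G b y k i m) = coordCLM b m ∘ fun y ↦ chrAt G y (b k) (b i) := by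
    funext y; rfl
  rw [hfun, h3.fderiv]
  rfl

/-- **The curvature components through the Christoffel symbols**:
`R^m_{jki} = ∂_jΓ^m_{ki} − ∂_kΓ^m_{ji} + Σ_p (Γ^p_{ki}Γ^m_{jp} − Γ^p_{ji}Γ^m_{kp})`
(O'Neill 1983, Ch. 3, Lemma 3.38). [cite: ONeill1983, Ch. 3, Lemma 3.38] -/
theorem IsMetricOn.riemCoef_eq_chrCoef [Fintype ι] [CompleteSpace E] [FiniteDimensional ℝ E]
    (hG : IsMetricOn G V) (hx : x ∈ V) (j k i m : ι) :
    riemCoef G b x j k i m =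
      fderiv ℝ (fun y ↦ chrCoef G b y k i m) x (b j) - fderiv ℝ (fun y ↦ chrCoef G b y j i m) x (b k)
        + ∑ p, (chrCoef G b x k i p * chrCoef G b x j p m - chrCoef G b x j i p * chrCoef G b x k p m) := by
  rw [riemCoef, riemAt_apply]
  simp only [map_add, map_sub, hG.fderiv_chrCoef b hx]
  rw [chrAt_basis_eq_sum b x k i, chrAt_basis_eq_sum b x j i]
  simp only [map_sum, map_smul, smul_eq_mul]
  rw [add_sub_assoc, ← Finset.sum_sub_distrib]
  rfl

end Riem

/-! ### The Ricci identity -/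

section Ricci

variable [Fintype ι] {G : E → E →L[ℝ] E →L[ℝ] ℝ} {b : Basis ι ℝ E} {α : Type*} [Fintype α] [DecidableEq α]
  {V : Set E} {x : E} [CompleteSpace E] [FiniteDimensional ℝ E]

/-- The off-diagonal part of the iterated Christoffel correction is symmetric in `(j, k)`.
[folklore] -/
theorem sum_offDiag_chr_comm (Γ : ι → ι → ι → ℝ) (T₀ : (α → ι) → ℝ) (I : α → ι) (j k : ι) :
    ∑ a, ∑ p : ι, ∑ a', ∑ m : ι, (if a' = a then 0 else
        Γ j (I a) p * Γ k (I a') m * T₀ (update (update I a p) a' m)) =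
      ∑ a, ∑ p : ι, ∑ a', ∑ m : ι, (if a' = a then 0 else
        Γ k (I a) p * Γ j (I a') m * T₀ (update (update I a p) a' m)) := by
  rw [sum_comm₂₂ fun (a : α) (p : ι) (a' : α) (m : ι) ↦ (if a' = a then 0 else
        Γ j (I a) p * Γ k (I a') m * T₀ (update (update I a p) a' m))]
  refine Finset.sum_congr rfl fun a _ ↦ Finset.sum_congr rfl fun p _ ↦
    Finset.sum_congr rfl fun a' _ ↦ Finset.sum_congr rfl fun m _ ↦ ?_
  by_cases h : a' = a
  · subst h; simp
  · rw [if_neg (fun h' ↦ h h'.symm), if_neg h, update_comm h]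
    ring

/-- Splitting the iterated Christoffel correction into its diagonal and off-diagonal parts.
[folklore] -/
theorem sum_chr_chr_update_update (Γ : ι → ι → ι → ℝ) (T₀ : (α → ι) → ℝ) (I : α → ι) (j k : ι) :
    ∑ a, ∑ p : ι, Γ j (I a) p * ∑ a', ∑ m : ι, Γ k (update I a p a') m * T₀ (update (update I a p) a' m) =
      ∑ a, ∑ m : ι, ∑ p : ι, Γ j (I a) p * Γ k p m * T₀ (update I a m)
        + ∑ a, ∑ p : ι, ∑ a', ∑ m : ι, (if a' = a then 0 else
            Γ j (I a) p * Γ k (I a') m * T₀ (update (update I a p) a' m)) := by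
  rw [← Finset.sum_add_distrib]
  refine Finset.sum_congr rfl fun a _ ↦ ?_
  rw [Finset.sum_comm (f := fun m p ↦ Γ j (I a) p * Γ k p m * T₀ (update I a m)), ← Finset.sum_add_distrib]
  refine Finset.sum_congr rfl fun p _ ↦ ?_
  rw [Finset.mul_sum, ← Finset.add_sum_erase _ _ (Finset.mem_univ a)]
  conv_rhs => rw [← Finset.add_sum_erase _ _ (Finset.mem_univ a)]
  simp only [update_self, update_idem, if_true, Finset.sum_const_zero, zero_add, Finset.mul_sum]
  congr 1
  · exact Finset.sum_congr rfl fun m _ ↦ by ring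
  · refine Finset.sum_congr rfl fun a' ha' ↦ ?_
    have hne : a' ≠ a := Finset.ne_of_mem_erase ha'
    refine Finset.sum_congr rfl fun m _ ↦ ?_
    rw [if_neg hne, update_of_ne hne]
    ring

/-- The expansion of `(∇∇T)_{jkI}` in terms of second derivatives of the components, first
derivatives and Christoffel symbols. [cite: ONeill1983, Ch. 2, Prop. 2.13] -/
theorem IsMetricOn.tcov_tcov_expand (hG : IsMetricOn G V) {T : E → (α → ι) → ℝ} (hT : TSmoothOn T V)
    (hx : x ∈ V) (j k : ι) (I : α → ι) :
    tcov G b (tcov G b T) x (ocons j (ocons k I)) =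
      fderiv ℝ (fderiv ℝ (fun y ↦ T y I)) x (b j) (b k)
      - ∑ a, ∑ m, fderiv ℝ (fun y ↦ chrCoef G b y k (I a) m) x (b j) * T x (update I a m)
      - ∑ a, ∑ m, chrCoef G b x k (I a) m * fderiv ℝ (fun y ↦ T y (update I a m)) x (b j)
      - ∑ p, chrCoef G b x j k p * tcov G b T x (ocons p I)
      - ∑ a, ∑ p, chrCoef G b x j (I a) p * fderiv ℝ (fun y ↦ T y (update I a p)) x (b k)
      + ∑ a, ∑ p, chrCoef G b x j (I a) p * ∑ a', ∑ m, chrCoef G b x k (update I a p a') m *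
          T x (update (update I a p) a' m) := by
  have hV := hG.isOpen
  have hTd : ∀ J, DifferentiableAt ℝ (fun y ↦ T y J) x := fun J ↦ hT.differentiableAt hV hx J
  have hΓd : ∀ q i m, DifferentiableAt ℝ (fun y ↦ chrCoef G b y q i m) x :=
    fun q i m ↦ hG.differentiableAt_chrCoef b hx q i m
  have hTfd : DifferentiableAt ℝ (fderiv ℝ (fun y ↦ T y I)) x :=
    (((hT I).fderiv_of_isOpen (m := ∞) hV (by simp)).contDiffAt (hV.mem_nhds hx)).differentiableAt
      (by simp)
  -- the derivative of `y ↦ (∇T)_{kI}(y)`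
  have hA : fderiv ℝ (fun y ↦ tcov G b T y (ocons k I)) x (b j) =
      fderiv ℝ (fderiv ℝ (fun y ↦ T y I)) x (b j) (b k)
      - ∑ a, ∑ m, (fderiv ℝ (fun y ↦ chrCoef G b y k (I a) m) x (b j) * T x (update I a m)
          + chrCoef G b x k (I a) m * fderiv ℝ (fun y ↦ T y (update I a m)) x (b j)) := by
    have hfun : (fun y ↦ tcov G b T y (ocons k I)) = fun y ↦ fderiv ℝ (fun z ↦ T z I) y (b k)
        - ∑ a, ∑ m, chrCoef G b y k (I a) m * T y (update I a m) := by
      funext y; rw [tcov_apply_ocons]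
    have hd1 : DifferentiableAt ℝ (fun y ↦ fderiv ℝ (fun z ↦ T z I) y (b k)) x :=
      differentiableAt_clm_apply_const hTfd (b k)
    have hdp : ∀ a m, DifferentiableAt ℝ (fun y ↦ chrCoef G b y k (I a) m * T y (update I a m)) x :=
      fun a m ↦ (hΓd _ _ _).fun_mul (hTd _)
    have hds : ∀ a, DifferentiableAt ℝ (fun y ↦ ∑ m, chrCoef G b y k (I a) m * T y (update I a m)) x :=
      fun a ↦ DifferentiableAt.fun_sum fun m _ ↦ hdp a m
    have hd2 : DifferentiableAt ℝ (fun y ↦ ∑ a, ∑ m, chrCoef G b y k (I a) m * T y (update I a m)) x :=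
      DifferentiableAt.fun_sum fun a _ ↦ hds a
    rw [hfun, fderiv_fun_sub hd1 hd2, _root_.sub_apply, fderiv_clm_apply_const hTfd (b k) (b j),
      fderiv_fun_sum fun a _ ↦ hds a, FunLike.coe_sum, Finset.sum_apply]
    congr 1
    refine Finset.sum_congr rfl fun a _ ↦ ?_
    rw [fderiv_fun_sum fun m _ ↦ hdp a m, FunLike.coe_sum, Finset.sum_apply]
    refine Finset.sum_congr rfl fun m _ ↦ ?_
    rw [fderiv_fun_mul (hΓd _ _ _) (hTd _)]
    simp only [_root_.add_apply, _root_.smul_apply, smul_eq_mul]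
    ring
  rw [tcov_apply_ocons, Fintype.sum_option]
  simp only [ocons_none, ocons_some, update_ocons_none, update_ocons_some]
  rw [hA]
  have hC : ∀ a p, tcov G b T x (ocons k (update I a p)) =
      fderiv ℝ (fun y ↦ T y (update I a p)) x (b k)
        - ∑ a', ∑ m, chrCoef G b x k (update I a p a') m * T x (update (update I a p) a' m) :=
    fun a p ↦ tcov_apply_ocons _ _ _ _
  simp only [hC, mul_sub, Finset.sum_sub_distrib, Finset.sum_add_distrib]
  ring

/-- **The Ricci identity for covariant tensor fields of arbitrary rank** (O'Neill 1983, Ch. 3,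
Prop. 3.36 ff.; Topping 2006, (2.1.5)–(2.1.6)): for a smooth field `T` of index type `α` and
`x ∈ V`,
`(∇∇T)_{jkI} − (∇∇T)_{kjI} = −Σ_a Σ_m R^m_{jk I_a} T_{I[a ↦ m]}`,
i.e. `∇²_{X,Y}T − ∇²_{Y,X}T = R(X,Y)·T` with the curvature acting as a derivation on the slots.
The proof is the classical component computation: the second derivatives of the components, the
`Γ^p_{jk}` term and the mixed `Γ ∂T` terms are symmetric in `(j,k)`, the off-diagonal `ΓΓ` terms are
symmetric (`sum_offDiag_chr_comm`), and what remains is `−R^m_{jkI_a}` by `riemCoef_eq_chrCoef`.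
[cite: ONeill1983, Ch. 3, Prop. 3.36] -/
theorem IsMetricOn.tcov_tcov_antisymm (hG : IsMetricOn G V) {T : E → (α → ι) → ℝ}
    (hT : TSmoothOn T V) (hx : x ∈ V) (j k : ι) (I : α → ι) :
    tcov G b (tcov G b T) x (ocons j (ocons k I)) - tcov G b (tcov G b T) x (ocons k (ocons j I)) =
      -∑ a, ∑ m, riemCoef G b x j k (I a) m * T x (update I a m) := by
  have hV := hG.isOpen
  have hD2 : fderiv ℝ (fderiv ℝ (fun y ↦ T y I)) x (b j) (b k) =
      fderiv ℝ (fderiv ℝ (fun y ↦ T y I)) x (b k) (b j) :=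
    ((hT I).contDiffAt (hV.mem_nhds hx)).isSymmSndFDerivAt two_le_infty (b j) (b k)
  have hX3 : ∑ p, chrCoef G b x j k p * tcov G b T x (ocons p I) =
      ∑ p, chrCoef G b x k j p * tcov G b T x (ocons p I) :=
    Finset.sum_congr rfl fun p _ ↦ by rw [hG.chrCoef_comm b hx j k p]
  have hR : ∀ a, ∑ m, riemCoef G b x j k (I a) m * T x (update I a m) =
      ∑ m, fderiv ℝ (fun y ↦ chrCoef G b y k (I a) m) x (b j) * T x (update I a m)
      - ∑ m, fderiv ℝ (fun y ↦ chrCoef G b y j (I a) m) x (b k) * T x (update I a m)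
      + ∑ m, ∑ p, chrCoef G b x k (I a) p * chrCoef G b x j p m * T x (update I a m)
      - ∑ m, ∑ p, chrCoef G b x j (I a) p * chrCoef G b x k p m * T x (update I a m) := by
    intro a
    simp only [hG.riemCoef_eq_chrCoef b hx, add_mul, sub_mul, Finset.sum_add_distrib,
      Finset.sum_sub_distrib, Finset.sum_mul]
    ring
  rw [hG.tcov_tcov_expand hT hx j k I, hG.tcov_tcov_expand hT hx k j I,
    sum_chr_chr_update_update (chrCoef G b x) (T x) I j k,
    sum_chr_chr_update_update (chrCoef G b x) (T x) I k j,
    sum_offDiag_chr_comm (chrCoef G b x) (T x) I j k, hD2, hX3,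
    Finset.sum_congr rfl fun a _ ↦ hR a]
  simp only [Finset.sum_add_distrib, Finset.sum_sub_distrib]
  ring

end Ricci

/-! ### The Ricci identity as an identity of fields; the commutator `[Δ, ∇]` -/

section Fields

variable [Fintype ι] {G : E → E →L[ℝ] E →L[ℝ] ℝ} {b : Basis ι ℝ E} {α : Type*} [Fintype α] [DecidableEq α]
  {V : Set E} {x : E}

/-- **The curvature acting on slot `a`**: `(ricTerm T a)_{jkI} = Σ_m R^m_{jk I_a} T_{I[a ↦ m]}`, a
tensor field of index type `Option (Option α)` (slots `j`, `k`, then those of `T`).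
[cite: ONeill1983, Ch. 3, Prop. 3.36] -/
def ricTerm (G : E → E →L[ℝ] E →L[ℝ] ℝ) (b : Basis ι ℝ E) (T : E → (α → ι) → ℝ) (a : α) :
    E → (Option (Option α) → ι) → ℝ :=
  fun x J ↦ ∑ m, riemCoef G b x (J none) (J (some none)) (J (some (some a))) m *
    T x (update (J ∘ some ∘ some) a m)

omit [Fintype α] in
/-- Unfolding lemma for `ricTerm` at prepended indices. [cite: ONeill1983, Ch. 3, Prop. 3.36] -/
theorem ricTerm_apply_ocons (T : E → (α → ι) → ℝ) (a : α) (x : E) (j k : ι) (I : α → ι) :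
    ricTerm G b T a x (ocons j (ocons k I)) = ∑ m, riemCoef G b x j k (I a) m * T x (update I a m) := rfl

/-- The antisymmetrisation of `∇∇T` in its two outer slots:
`W T = ∇∇T − (∇∇T) ∘ swap`, `(W T)_{jkI} = (∇∇T)_{jkI} − (∇∇T)_{kjI}`. [cite: Topping2006, §2.1, (2.1.5)] -/
def tcov2Alt (G : E → E →L[ℝ] E →L[ℝ] ℝ) (b : Basis ι ℝ E) (T : E → (α → ι) → ℝ) :
    E → (Option (Option α) → ι) → ℝ :=
  tcov G b (tcov G b T) - treindex (Equiv.swap none (some none)) (tcov G b (tcov G b T))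

omit [Fintype ι] [Fintype α] in
/-- Swapping the two prepended indices. [folklore] -/
theorem ocons_ocons_comp_swap (j k : ι) (I : α → ι) :
    ocons j (ocons k I) ∘ (Equiv.swap none (some none) : Equiv.Perm (Option (Option α))) =
      ocons k (ocons j I) := by
  funext o
  rcases o with _ | _ | a
  · simp
  · simp
  · simp only [Function.comp_apply]
    rw [Equiv.swap_apply_of_ne_of_ne (by simp) (by simp)]
    rfl

omit [Fintype ι] [Fintype α] in
/-- Swapping the second and third prepended indices. [folklore] -/
theorem ocons_ocons_ocons_comp_swap (p q i : ι) (I : α → ι) :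
    ocons p (ocons q (ocons i I)) ∘
        (Equiv.swap (some none) (some (some none)) : Equiv.Perm (Option (Option (Option α)))) =
      ocons p (ocons i (ocons q I)) := by
  funext o
  rcases o with _ | _ | _ | a
  · simp only [Function.comp_apply]
    rw [Equiv.swap_apply_of_ne_of_ne (by simp) (by simp)]
    rfl
  · simp
  · simp
  · simp only [Function.comp_apply]
    rw [Equiv.swap_apply_of_ne_of_ne (by simp) (by simp)]
    rfl

/-- Unfolding lemma for `tcov2Alt`. [cite: Topping2006, §2.1, (2.1.5)] -/
theorem tcov2Alt_apply_ocons (T : E → (α → ι) → ℝ) (x : E) (j k : ι) (I : α → ι) :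
    tcov2Alt G b T x (ocons j (ocons k I)) =
      tcov G b (tcov G b T) x (ocons j (ocons k I)) - tcov G b (tcov G b T) x (ocons k (ocons j I)) := by
  simp only [tcov2Alt, Pi.sub_apply, treindex_apply, ocons_ocons_comp_swap]

variable [CompleteSpace E] [FiniteDimensional ℝ E]

/-- **The Ricci identity as an identity of fields on `V`**: `W T = −Σ_a ricTerm T a`.
[cite: ONeill1983, Ch. 3, Prop. 3.36] -/
theorem IsMetricOn.tcov2Alt_eq (hG : IsMetricOn G V) {T : E → (α → ι) → ℝ} (hT : TSmoothOn T V) :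
    ∀ y ∈ V, ∀ J, tcov2Alt G b T y J = -∑ a, ricTerm G b T a y J := by
  intro y hy J
  obtain ⟨j, k, I, rfl⟩ : ∃ j k I, J = ocons j (ocons k I) :=
    ⟨J none, J (some none), J ∘ some ∘ some, by funext o; rcases o with _ | _ | a <;> rfl⟩
  rw [tcov2Alt_apply_ocons, hG.tcov_tcov_antisymm hT hy]
  simp only [ricTerm_apply_ocons]

omit [Fintype α] in
/-- `ricTerm T a` is `C^∞` on `V`. [folklore] -/
theorem IsMetricOn.tsmoothOn_ricTerm (hG : IsMetricOn G V) {T : E → (α → ι) → ℝ} (hT : TSmoothOn T V)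
    (a : α) : TSmoothOn (ricTerm G b T a) V := by
  intro J
  simp only [ricTerm]
  refine ContDiffOn.sum fun m _ ↦ ContDiffOn.mul ?_ (hT _)
  have h : ContDiffOn ℝ ∞ (fun y ↦ riemAt G y (b (J none)) (b (J (some none))) (b (J (some (some a))))) V :=
    hG.contDiffOn_riemAt_apply _ _ _
  exact (coordCLM b m).contDiff.comp_contDiffOn h

/-- `tcov2Alt T` is `C^∞` on `V`. [folklore] -/
theorem IsMetricOn.tsmoothOn_tcov2Alt (hG : IsMetricOn G V) {T : E → (α → ι) → ℝ} (hT : TSmoothOn T V) :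
    TSmoothOn (tcov2Alt G b T) V :=
  (hG.tsmoothOn_tcov (hG.tsmoothOn_tcov hT)).sub ((hG.tsmoothOn_tcov (hG.tsmoothOn_tcov hT)).treindex _)

omit [Fintype ι] [Fintype α] [DecidableEq α] [CompleteSpace E] [FiniteDimensional ℝ E] in
/-- A finite sum of smooth fields is smooth. [folklore] -/
theorem TSmoothOn.sum {κ : Type*} (s : Finset κ) {F : κ → E → (α → ι) → ℝ}
    (hF : ∀ c ∈ s, TSmoothOn (F c) V) : TSmoothOn (∑ c ∈ s, F c) V := by
  intro I
  have : (fun y ↦ (∑ c ∈ s, F c) y I) = fun y ↦ ∑ c ∈ s, F c y I := by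
    funext y; simp [Finset.sum_apply]
  rw [this]
  exact ContDiffOn.sum fun c hc ↦ hF c hc I

omit [CompleteSpace E] [FiniteDimensional ℝ E] in
/-- `∇` of a finite sum of smooth fields (at points of the open set). [folklore] -/
theorem tcov_sum_apply {κ : Type*} (s : Finset κ) (hV : IsOpen V) {F : κ → E → (α → ι) → ℝ}
    (hF : ∀ c ∈ s, TSmoothOn (F c) V) (hx : x ∈ V) (J : Option α → ι) :
    tcov G b (∑ c ∈ s, F c) x J = ∑ c ∈ s, tcov G b (F c) x J := by
  classical
  induction s using Finset.induction_on with
  | empty => simp [tcov_zero]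
  | insert c s hc ih =>
    have hs : ∀ c' ∈ s, TSmoothOn (F c') V := fun c' hc' ↦ hF c' (Finset.mem_insert_of_mem hc')
    rw [Finset.sum_insert hc, Finset.sum_insert hc,
      tcov_add_apply hV (hF c (Finset.mem_insert_self c s)) (TSmoothOn.sum s hs) hx, ih hs]

/-- **The commutator of the rough Laplacian with `∇`** (Topping 2006, (2.1.6):
`∇(ΔT) = Δ(∇T) + Rm * ∇T + ∇Rm * T` structurally): on `V`,
`(Δ∇T − ∇ΔT)_{iI} = Σ_{pq} g^{pq} [(∇ W T)_{pqiI} + (W ∇T)_{piqI}]`, i.e.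
`Δ∇T − ∇ΔT = tr (∇(W T) + (W (∇T)) ∘ σ)` with `W = tcov2Alt` the antisymmetrised second
covariant derivative (`= −Σ_a ricTerm`, `tcov2Alt_eq`) and `σ` the swap of the second and third
slots. [cite: Topping2006, §2.1, (2.1.6)] -/
theorem IsMetricOn.tlap_tcov_sub_tcov_tlap (hG : IsMetricOn G V) {T : E → (α → ι) → ℝ}
    (hT : TSmoothOn T V) (hx : x ∈ V) (i : ι) (I : α → ι) :
    tlap G b (tcov G b T) x (ocons i I) - tcov G b (tlap G b T) x (ocons i I) =
      ttr G b (tcov G b (tcov2Alt G b T)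
        + treindex (Equiv.swap (some none) (some (some none))) (tcov2Alt G b (tcov G b T)))
          x (ocons i I) := by
  have hV := hG.isOpen
  have h2 : TSmoothOn (tcov G b (tcov G b T)) V := hG.tsmoothOn_tcov (hG.tsmoothOn_tcov hT)
  rw [tlap_apply, show tlap G b T = ttr G b (tcov G b (tcov G b T)) from rfl, hG.tcov_ttr h2 hx,
    ttr_apply, ← Finset.sum_sub_distrib]
  refine Finset.sum_congr rfl fun p _ ↦ ?_
  rw [← Finset.sum_sub_distrib]
  refine Finset.sum_congr rfl fun q _ ↦ ?_
  rw [← mul_sub, Pi.add_apply, Pi.add_apply, treindex_apply, ocons_ocons_ocons_comp_swap,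
    tcov2Alt_apply_ocons,
    show tcov2Alt G b T = tcov G b (tcov G b T)
      - treindex (Equiv.swap none (some none)) (tcov G b (tcov G b T)) from rfl,
    tcov_sub_apply hV h2 (h2.treindex _) hx, tcov_treindex, treindex_apply]
  congr 1
  have hsw : ocons p (ocons q (ocons i I)) ∘ ⇑(Equiv.optionCongr (Equiv.swap none (some none))) =
      ocons p (ocons i (ocons q I)) := by
    rw [ocons_comp_optionCongr, ocons_ocons_comp_swap]
  rw [hsw]
  ring

end Fields

/-! ### The curvature action as a double trace of a tensor product -/

section RicEquiv

variable {α : Type*} [DecidableEq α]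

/-- The relabelling behind `ricTerm T a = tr ((Rm ⊗ T) ∘ e_a)`: forward map. [folklore] -/
def ricEquivFun (a : α) : Fin 4 ⊕ α → Option (Option (Option (Option α)))
  | Sum.inl i => ![some (some none), some (some (some none)), some (some (some (some a))), some none] i
  | Sum.inr a' => if a' = a then none else some (some (some (some a')))

/-- The relabelling behind `ricTerm T a = tr ((Rm ⊗ T) ∘ e_a)`: inverse map. [folklore] -/
def ricEquivInv (a : α) : Option (Option (Option (Option α))) → Fin 4 ⊕ α
  | none => Sum.inr a
  | some none => Sum.inl 3
  | some (some none) => Sum.inl 0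
  | some (some (some none)) => Sum.inl 1
  | some (some (some (some a'))) => if a' = a then Sum.inl 2 else Sum.inr a'

/-- **The relabelling `e_a : Fin 4 ⊕ α ≃ Option⁴ α`** placing the slots of `Rm ⊗ T` so that the
double trace of the two outermost slots produces `Σ_m R^m_{jkI_a} T_{I[a↦m]}`: the curvature slots
go to `j`, `k`, the output slot `a` and the second traced slot; the slot `a` of `T` goes to the
first traced slot, its other slots stay. [folklore] -/
def ricEquiv (a : α) : Fin 4 ⊕ α ≃ Option (Option (Option (Option α))) where
  toFun := ricEquivFun a
  invFun := ricEquivInv a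
  left_inv := by
    rintro (i | a')
    · fin_cases i <;> simp [ricEquivFun, ricEquivInv]
    · by_cases h : a' = a
      · subst h; simp [ricEquivFun, ricEquivInv]
      · simp [ricEquivFun, ricEquivInv, h]
  right_inv := by
    rintro (_ | _ | _ | _ | a')
    · simp [ricEquivFun, ricEquivInv]
    · simp [ricEquivFun, ricEquivInv]
    · simp [ricEquivFun, ricEquivInv]
    · simp [ricEquivFun, ricEquivInv]
    · by_cases h : a' = a
      · subst h; simp [ricEquivFun, ricEquivInv]
      · simp [ricEquivFun, ricEquivInv, h]

variable {ι : Type*}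

/-- The curvature slots under `e_a`. [folklore] -/
theorem ocons₄_comp_ricEquiv_inl (a : α) (p q j k : ι) (I : α → ι) :
    (ocons p (ocons q (ocons j (ocons k I))) ∘ ricEquiv a) ∘ Sum.inl = ![j, k, I a, q] := by
  funext i
  fin_cases i <;> rfl

/-- The slots of `T` under `e_a`. [folklore] -/
theorem ocons₄_comp_ricEquiv_inr (a : α) (p q j k : ι) (I : α → ι) :
    (ocons p (ocons q (ocons j (ocons k I))) ∘ ricEquiv a) ∘ Sum.inr = update I a p := by
  funext a'
  by_cases h : a' = a
  · subst h
    simp [ricEquiv, ricEquivFun]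
  · rw [update_of_ne h]
    simp [ricEquiv, ricEquivFun, h]

end RicEquiv

section RicTermTrace

variable [Fintype ι] {G : E → E →L[ℝ] E →L[ℝ] ℝ} {b : Basis ι ℝ E} {α : Type*} [Fintype α] [DecidableEq α]
  {V : Set E} {x : E} [FiniteDimensional ℝ E]

omit [Fintype α] in
/-- `tr((Rm ⊗ T) ∘ e_a)_{jkI} = Σ_{pq} g^{pq} R_{jk I_a q} T_{I[a ↦ p]}`. [folklore] -/
theorem ttr_treindex_ricEquiv_apply (T : E → (α → ι) → ℝ) (a : α) (x : E) (j k : ι) (I : α → ι) :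
    ttr G b (treindex (ricEquiv a) (tprod (rm4 G b) T)) x (ocons j (ocons k I)) =
      ∑ p, ∑ q, ginv G b x p q * (rm4 G b x ![j, k, I a, q] * T x (update I a p)) := by
  rw [ttr_apply]
  refine Finset.sum_congr rfl fun p _ ↦ Finset.sum_congr rfl fun q _ ↦ ?_
  rw [treindex_apply, tprod_apply, ocons₄_comp_ricEquiv_inl, ocons₄_comp_ricEquiv_inr]

omit [Fintype α] in
/-- **The curvature action on slot `a` is the double trace of the relabelled tensor product**:
at points where `G x` is invertible, `ricTerm T a = tr ((Rm ⊗ T) ∘ e_a)` componentwise.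
[cite: ONeill1983, Ch. 3, Prop. 3.36] -/
theorem ricTerm_eq_ttr (hx : (G x).IsInvertible) (T : E → (α → ι) → ℝ) (a : α) (J : Option (Option α) → ι) :
    ricTerm G b T a x J = ttr G b (treindex (ricEquiv a) (tprod (rm4 G b) T)) x J := by
  obtain ⟨j, k, I, rfl⟩ : ∃ j k I, J = ocons j (ocons k I) :=
    ⟨J none, J (some none), J ∘ some ∘ some, by funext o; rcases o with _ | _ | a <;> rfl⟩
  rw [ricTerm_apply_ocons, ttr_treindex_ricEquiv_apply]
  refine Finset.sum_congr rfl fun p _ ↦ ?_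
  rw [riemCoef_eq_sum_ginv b hx, Finset.sum_mul]
  exact Finset.sum_congr rfl fun q _ ↦ by ring

omit [Fintype α] in
/-- Field form of `ricTerm_eq_ttr` on `V`. [cite: ONeill1983, Ch. 3, Prop. 3.36] -/
theorem IsMetricOn.ricTerm_eq_ttr (hG : IsMetricOn G V) (T : E → (α → ι) → ℝ) (a : α) :
    ∀ y ∈ V, ∀ J, ricTerm G b T a y J = ttr G b (treindex (ricEquiv a) (tprod (rm4 G b) T)) y J :=
  fun y hy J ↦ MetricCoord.ricTerm_eq_ttr (hG.isInvertible y hy) T a J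

end RicTermTrace

end MetricCoord

end Literature.Geometry.Lorentzian

end
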